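import Summits.CriticalPhenomena.PercolationContinuityZ3.Theorems.PercNearOneGluingNoHeavyLowerTailSahiCombTriWGeneral

/-!
# `TRI_W ≥ 0` on the cells `(c,2,2)` of the triangle class — the certificate KIT (codes, pointwise tables, atoms, the generic check theorem)

Support file of the one-cut programme (crux `NoHeavyLowerTail`, stmt-CriticalPhenomena-4575; lemma factory `prim-lf-1`, gen 28;
memos `FROM-prim-lf-1-gen27-CELL22-AND-G0GP.md` §5, `FROM-prim-lf-1-gen28-….md`).

SETTING.  `FiveUpSet.triW P F G` (`…SahiCombTriWGeneral`) with an index cube `Finset ζ` of ANY dimension and the FIXED cube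
`W = Finset (Fin 4) = X × Y` (`X` = coordinates `0,1`, `Y` = coordinates `2,3`), `P ⊆ W` an arbitrary up-set, `F z` an `X`-CYLINDER up-set
(membership depends on `w ∩ {0,1}` only; six of them, `cylX u`, `u : Fin 6`) and `G z` a `Y`-cylinder up-set (`cylY v`).  With `U₁ = g`
reading `(X,Z)`, `U₂ = h` reading `(Y,Z)`, `U₃ = f = P` reading `(X,Y)` this is the triangle-class coefficient `TRI` of (M⁺⁺-3) on every cell
whose block sizes are `(|Z|, 2, 2)`, `|Z|` arbitrary (report P5 §10.3/§11.10; the index cube is the block shared by `U₁, U₂`).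

METHOD (gen 27 §5, here made kernel-checkable).  `2·triW = Σ_z tsym(f; code z, code zᶜ)` where `code z = (u,v) ∈ Fin 6 × Fin 6` records
`(F z, G z)`; for each of the 168 up-sets `f` of `2^4` a finite CERTIFICATE — non-negative integer multiples of instances of the five-up-set
theorem (`fiveUpSetIneq_holds`) and of Kleitman's lemma (`card_inter_refl_le`) on the index cube `Finset ζ`, whose up-sets are pull-backs
`{z : code z ∈ S}` of up-sets `S` of the 36-element poset `M = Up(X) × Up(Y)` — is dominated POINTWISE in `(code z, code zᶜ) ∈ M²` by
`D · tsym`.  This file provides the codes and tables (`tX`, `tY`, `kpt`, `tval`, `tsym`), the bridge `triWTerm = tval` / `2·triW = Σ tsym`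
(`two_mul_triW_eq_sum_tsym`), and the COVERING of the 168 up-sets `P ⊆ W` by pairs of byte masks (`L20`, `cover8`, `exists_masks`).  The atoms, the checker and the
generic theorem `triW_nonneg_of_check` are in `…SahiCombCellTwoTwoAtoms`; the 168 certificates in `…SahiCombCellTwoTwoCertA/B/C/D`; the cell
theorem in `…SahiCombCellTwoTwo`.
HONEST LABEL: infrastructure (definitions + generic lemmas); no cell is settled in this file. [this work]
-/

namespace Summit.CriticalPhenomena.PercolationContinuityZ3.Theorems

namespace FiveUpSet

namespace Cell22

open Finset

/-! ### Codes and pointwise tables (pure `ℕ`/`Bool`/`ℤ` data, evaluated by `decide +kernel` in the certificate files) -/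

/-- `x`-bitmasks of the six up-sets of the square `X = 2^{p,q}` in the order `∅, {⊤}, {p,⊤}, {q,⊤}, {p,q,⊤}, X`
(a point `x ⊆ {p,q}` is coded `p ↦ bit 0`, `q ↦ bit 1`). [this work] -/
def ups6 (u : ℕ) : ℕ :=
  if u = 0 then 0 else if u = 1 then 8 else if u = 2 then 10 else if u = 3 then 12 else if u = 4 then 14 else 15

/-- Membership of the `W`-point with code `t` (bit `k` ↔ coordinate `k ∈ w`) in the `X`-cylinder with code `u` (`X` = coordinates `0,1`). [this work] -/
def tX (u t : ℕ) : Bool := (ups6 u).testBit (t % 4)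

/-- Membership of the `W`-point with code `t` in the `Y`-cylinder with code `v` (`Y` = coordinates `2,3`). [this work] -/
def tY (v t : ℕ) : Bool := (ups6 v).testBit (t / 4)

/-- `Bool ↦ {0,1} ⊆ ℤ`. [this work] -/
def b2z (b : Bool) : ℤ := if b = true then 1 else 0

/-- The integrand of `triWTerm` at the `W`-point `t` for the codes `(u, v, v')` of `(F z, G z, G zᶜ)`; `15 - t` codes the complement point. [this work] -/
def kpt (u v v' t : ℕ) : ℤ :=
  2 * b2z (tX u t && tY v t) - b2z (tX u (15 - t) && tY v' t) - b2z (tX u t && tY v' (15 - t))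
    - b2z (tX u (15 - t) && tY v (15 - t)) + b2z (tX u (15 - t) && tY v' (15 - t))

/-- Unrolled sum over the sixteen point codes. [this work] -/
def sum16 (f : ℕ → ℤ) : ℤ :=
  f 0 + f 1 + f 2 + f 3 + f 4 + f 5 + f 6 + f 7 + f 8 + f 9 + f 10 + f 11 + f 12 + f 13 + f 14 + f 15

/-- The mask of `P ⊆ W` as two bytes: `n₀` for the eight points not containing coordinate `3` (codes `0..7`), `n₁` for the others. [this work] -/
def pmask (n₀ n₁ t : ℕ) : Bool := if t < 8 then n₀.testBit t else n₁.testBit (t - 8)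

/-- `triWTerm` as a table: `tval n₀ n₁ u v v' = Σ_{t ∈ P} kpt u v v' t`. [this work] -/
def tval (n₀ n₁ u v v' : ℕ) : ℤ := sum16 fun t => if pmask n₀ n₁ t = true then kpt u v v' t else 0

/-- The symmetrised pair term `tval(z) + tval(zᶜ)` as a function of `(code z, code zᶜ) = ((u,v),(u',v'))`. [this work] -/
def tsym (n₀ n₁ u v u' v' : ℕ) : ℤ := tval n₀ n₁ u v v' + tval n₀ n₁ u' v' v

/-! ### The cube `W = Finset (Fin 4)` and its point codes -/

/-- Code of a point of `W`. [this work] -/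
def enc (w : Finset (Fin 4)) : ℕ := ∑ i ∈ w, 2 ^ (i : ℕ)

/-- Point of `W` with a given code. [this work] -/
def dec (t : ℕ) : Finset (Fin 4) := univ.filter fun i => t.testBit i = true

/-- Codes are `< 16`. [this work] -/
theorem enc_lt (w : Finset (Fin 4)) : enc w < 16 := by revert w; decide

/-- `dec ∘ enc = id`. [this work] -/
theorem dec_enc (w : Finset (Fin 4)) : dec (enc w) = w := by revert w; decide

/-- `enc ∘ dec = id` below `16`. [this work] -/
theorem enc_dec : ∀ t < 16, enc (dec t) = t := by decide

/-- The code of the complement point. [this work] -/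
theorem enc_compl (w : Finset (Fin 4)) : enc wᶜ = 15 - enc w := by revert w; decide

/-- `dec` is monotone in the bitmask order. [this work] -/
theorem dec_subset_dec : ∀ t < 16, ∀ t' < 16, t &&& t' = t → dec t ⊆ dec t' := by decide

/-- A sum over the points of `W` is the unrolled sum over codes. [this work] -/
theorem sum_enc (g : ℕ → ℤ) : ∑ w : Finset (Fin 4), g (enc w) = sum16 g := by
  have h : ∑ w : Finset (Fin 4), g (enc w) = ∑ t ∈ range 16, g t := by
    refine Finset.sum_bij' (fun w _ => enc w) (fun t _ => dec t) ?_ ?_ ?_ ?_ ?_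
    · intro w _; exact mem_range.2 (enc_lt w)
    · intro t _; exact mem_univ _
    · intro w _; exact dec_enc w
    · intro t ht; exact enc_dec t (mem_range.1 ht)
    · intro w _; rfl
  rw [h]
  simp [sum16, Finset.sum_range_succ]

/-- The `X`-cylinder up-set of `W` with code `u`. [this work] -/
def cylX (u : Fin 6) : Finset (Finset (Fin 4)) := univ.filter fun w => tX u (enc w) = true

/-- The `Y`-cylinder up-set of `W` with code `v`. [this work] -/
def cylY (v : Fin 6) : Finset (Finset (Fin 4)) := univ.filter fun w => tY v (enc w) = true

/-- Membership in `cylX`. [this work] -/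
theorem mem_cylX {u : Fin 6} {w : Finset (Fin 4)} : w ∈ cylX u ↔ tX u (enc w) = true := by simp [cylX]

/-- Membership in `cylY`. [this work] -/
theorem mem_cylY {v : Fin 6} {w : Finset (Fin 4)} : w ∈ cylY v ↔ tY v (enc w) = true := by simp [cylY]

/-- Membership in the antipodal image of `cylX`. [this work] -/
theorem mem_refl_cylX {u : Fin 6} {w : Finset (Fin 4)} : w ∈ refl (cylX u) ↔ tX u (15 - enc w) = true := by
  rw [mem_refl, mem_cylX, enc_compl]

/-- Membership in the antipodal image of `cylY`. [this work] -/
theorem mem_refl_cylY {v : Fin 6} {w : Finset (Fin 4)} : w ∈ refl (cylY v) ↔ tY v (15 - enc w) = true := by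
  rw [mem_refl, mem_cylY, enc_compl]

/-- The cylinders are up-sets. [this work] -/
theorem isUpperSet_cylX (u : Fin 6) : IsUpperSet (cylX u : Set (Finset (Fin 4))) := by
  have key : ∀ u : Fin 6, ∀ w w' : Finset (Fin 4), w ⊆ w' → tX u (enc w) = true → tX u (enc w') = true := by decide
  intro w w' hww' hw
  rw [mem_coe, mem_cylX] at hw ⊢
  exact key u w w' hww' hw

/-- The cylinders are up-sets. [this work] -/
theorem isUpperSet_cylY (v : Fin 6) : IsUpperSet (cylY v : Set (Finset (Fin 4))) := by
  have key : ∀ v : Fin 6, ∀ w w' : Finset (Fin 4), w ⊆ w' → tY v (enc w) = true → tY v (enc w') = true := by decide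
  intro w w' hww' hw
  rw [mem_coe, mem_cylY] at hw ⊢
  exact key v w w' hww' hw

/-- The inclusion order of the six up-sets of the square, on codes. [this work] -/
def le6 (u w : ℕ) : Bool := (ups6 u &&& ups6 w) == ups6 u

/-- Inclusion of cylinders is the code order. [this work] -/
theorem le6_of_cylX_subset : ∀ u w : Fin 6, cylX u ⊆ cylX w → le6 u w = true := by decide

/-- Inclusion of cylinders is the code order. [this work] -/
theorem le6_of_cylY_subset : ∀ u w : Fin 6, cylY u ⊆ cylY w → le6 u w = true := by decide

/-! ### The bridge `triWTerm = tval`, `2·triW = Σ tsym` -/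

/-- Counting a triple intersection inside `P` through Boolean membership tables. [this work] -/
theorem card_inter_inter_eq_sum_b2z (P A B : Finset (Finset (Fin 4))) (a b : Finset (Fin 4) → Bool)
    (ha : ∀ w, w ∈ A ↔ a w = true) (hb : ∀ w, w ∈ B ↔ b w = true) :
    ((P ∩ A ∩ B).card : ℤ) = ∑ w ∈ P, b2z (a w && b w) := by
  have hPAB : P ∩ A ∩ B = P.filter (fun w => (a w && b w) = true) := by
    ext w; simp only [mem_inter, mem_filter, ha, hb, Bool.and_eq_true, and_assoc]
  rw [hPAB, natCast_card_filter]
  rfl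

variable {ζ : Type} [DecidableEq ζ] [Fintype ζ]

/-- **`triWTerm` is the table `tval`** for cylinder families and the two-byte mask of `P`. [this work] -/
theorem triWTerm_eq_tval (P : Finset (Finset (Fin 4))) (F G : Finset ζ → Finset (Finset (Fin 4))) (gc hc : Finset ζ → Fin 6)
    (hF : ∀ z, F z = cylX (gc z)) (hG : ∀ z, G z = cylY (hc z)) (n₀ n₁ : ℕ)
    (hP : ∀ t < 16, (pmask n₀ n₁ t = true ↔ dec t ∈ P)) (z : Finset ζ) :
    triWTerm P F G z = tval n₀ n₁ (gc z) (hc z) (hc zᶜ) := by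
  unfold triWTerm
  rw [hF z, hG z, hG zᶜ]
  rw [card_inter_inter_eq_sum_b2z P _ _ (fun w => tX (gc z) (enc w)) (fun w => tY (hc z) (enc w))
        (fun w => mem_cylX) (fun w => mem_cylY),
      card_inter_inter_eq_sum_b2z P _ _ (fun w => tX (gc z) (15 - enc w)) (fun w => tY (hc zᶜ) (enc w))
        (fun w => mem_refl_cylX) (fun w => mem_cylY),
      card_inter_inter_eq_sum_b2z P _ _ (fun w => tX (gc z) (enc w)) (fun w => tY (hc zᶜ) (15 - enc w))
        (fun w => mem_cylX) (fun w => mem_refl_cylY),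
      card_inter_inter_eq_sum_b2z P _ _ (fun w => tX (gc z) (15 - enc w)) (fun w => tY (hc z) (15 - enc w))
        (fun w => mem_refl_cylX) (fun w => mem_refl_cylY),
      card_inter_inter_eq_sum_b2z P _ _ (fun w => tX (gc z) (15 - enc w)) (fun w => tY (hc zᶜ) (15 - enc w))
        (fun w => mem_refl_cylX) (fun w => mem_refl_cylY)]
  have hsum : ∑ w ∈ P, kpt (gc z) (hc z) (hc zᶜ) (enc w) = tval n₀ n₁ (gc z) (hc z) (hc zᶜ) := by
    have hPf : P = univ.filter (fun w => w ∈ P) := by ext w; simp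
    rw [hPf, Finset.sum_filter]
    have hite : ∀ w : Finset (Fin 4), (if w ∈ P then kpt (gc z) (hc z) (hc zᶜ) (enc w) else 0)
        = (if pmask n₀ n₁ (enc w) = true then kpt (gc z) (hc z) (hc zᶜ) (enc w) else 0) := by
      intro w
      have h := hP (enc w) (enc_lt w)
      rw [dec_enc] at h
      by_cases hw : w ∈ P
      · rw [if_pos hw, if_pos (h.2 hw)]
      · rw [if_neg hw, if_neg (fun h' => hw (h.1 h'))]
    rw [Finset.sum_congr rfl (fun w _ => hite w)]
    exact sum_enc (fun t => if pmask n₀ n₁ t = true then kpt (gc z) (hc z) (hc zᶜ) t else 0)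
  rw [← hsum]
  simp only [kpt, Finset.sum_add_distrib, Finset.sum_sub_distrib, Finset.mul_sum]

/-- **`2 · triW = Σ_z tsym (code z, code zᶜ)`** for cylinder families. [this work] -/
theorem two_mul_triW_eq_sum_tsym (P : Finset (Finset (Fin 4))) (F G : Finset ζ → Finset (Finset (Fin 4))) (gc hc : Finset ζ → Fin 6)
    (hF : ∀ z, F z = cylX (gc z)) (hG : ∀ z, G z = cylY (hc z)) (n₀ n₁ : ℕ)
    (hP : ∀ t < 16, (pmask n₀ n₁ t = true ↔ dec t ∈ P)) :
    2 * triW P F G = ∑ z : Finset ζ, tsym n₀ n₁ (gc z) (hc z) (gc zᶜ) (hc zᶜ) := by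
  unfold triW
  rw [Finset.sum_congr rfl (fun z _ => triWTerm_eq_tval P F G gc hc hF hG n₀ n₁ hP z)]
  have hre : ∑ z : Finset ζ, tval n₀ n₁ (gc zᶜ) (hc zᶜ) (hc z) = ∑ z : Finset ζ, tval n₀ n₁ (gc z) (hc z) (hc zᶜ) :=
    Fintype.sum_equiv (complEquiv ζ) _ _ (fun z => by simp [complEquiv])
  unfold tsym
  rw [Finset.sum_add_distrib, hre]
  ring

/-! ### Covering the up-sets of `W` by pairs of byte masks -/

/-- Bitmask inclusion of 3-bit point codes (`dec s ⊆ dec s'`). [this work] -/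
def sub8 (s s' : ℕ) : Bool := (s &&& s') == s

/-- Bitwise inclusion of bytes. [this work] -/
def sub8mask (n₀ n₁ : ℕ) : Bool := decide (∀ s : Fin 8, n₀.testBit s = true → n₁.testBit s = true)

/-- The twenty byte masks of the up-sets of the 3-cube `{w ⊆ {0,1,2}}` (bit `s` ↔ the point `dec s`). [this work] -/
def L20 : List ℕ := [0, 128, 136, 160, 168, 170, 192, 200, 204, 224, 232, 234, 236, 238, 240, 248, 250, 252, 254, 255]

/-- Monotonicity of `dec` on the low byte. [this work] -/
theorem dec_mono_low : ∀ s s' : Fin 8, sub8 s s' = true → dec s ⊆ dec s' := by decide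

/-- Monotonicity of `dec` on the high byte. [this work] -/
theorem dec_mono_high : ∀ s s' : Fin 8, sub8 s s' = true → dec (s + 8) ⊆ dec (s' + 8) := by decide

/-- Each low point lies below the corresponding high point. [this work] -/
theorem dec_low_subset_high : ∀ s : Fin 8, dec s ⊆ dec (s + 8) := by decide

/-- **Covering**: every up-set of the 3-cube, presented as a set of codes, has one of the twenty byte masks. [this work] -/
theorem cover8 : ∀ T : Finset (Fin 8), (∀ s s' : Fin 8, sub8 s s' = true → s ∈ T → s' ∈ T) →
    ∃ n ∈ L20, ∀ s : Fin 8, (n.testBit s = true ↔ s ∈ T) := by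
  decide +kernel

/-- **The masks of an up-set `P ⊆ W`**: two of the twenty bytes, nested, reproducing membership in `P` through `pmask`. [this work] -/
theorem exists_masks (P : Finset (Finset (Fin 4))) (hP : IsUpperSet (P : Set (Finset (Fin 4)))) :
    ∃ n₀ ∈ L20, ∃ n₁ ∈ L20, sub8mask n₀ n₁ = true ∧ ∀ t < 16, (pmask n₀ n₁ t = true ↔ dec t ∈ P) := by
  obtain ⟨n₀, h₀, e₀⟩ := cover8 (univ.filter fun s : Fin 8 => dec (s : ℕ) ∈ P) (by
    intro s s' hss' hs
    rw [mem_filter] at hs ⊢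
    exact ⟨mem_univ _, hP (dec_mono_low s s' hss') hs.2⟩)
  obtain ⟨n₁, h₁, e₁⟩ := cover8 (univ.filter fun s : Fin 8 => dec ((s : ℕ) + 8) ∈ P) (by
    intro s s' hss' hs
    rw [mem_filter] at hs ⊢
    exact ⟨mem_univ _, hP (dec_mono_high s s' hss') hs.2⟩)
  refine ⟨n₀, h₀, n₁, h₁, ?_, ?_⟩
  · apply decide_eq_true
    intro s hs
    have h := (e₀ s).1 hs
    rw [mem_filter] at h
    have h' : s ∈ univ.filter fun s : Fin 8 => dec ((s : ℕ) + 8) ∈ P :=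
      mem_filter.2 ⟨mem_univ _, hP (dec_low_subset_high s) h.2⟩
    exact (e₁ s).2 h'
  · intro t ht
    unfold pmask
    by_cases h8 : t < 8
    · rw [if_pos h8]
      have := e₀ ⟨t, h8⟩
      rw [mem_filter] at this
      simpa using this
    · rw [if_neg h8]
      have h' : t - 8 < 8 := by omega
      have := e₁ ⟨t - 8, h'⟩
      rw [mem_filter] at this
      have ht8 : t - 8 + 8 = t := by omega
      simpa [ht8] using this

end Cell22

end FiveUpSet

end Summit.CriticalPhenomena.PercolationContinuityZ3.Theorems
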